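import Mathlib.Analysis.InnerProductSpace.PiL2
import Mathlib.Analysis.Normed.Lp.MeasurableSpace
import Mathlib.MeasureTheory.Constructions.Cylinders
import Mathlib.Analysis.LocallyConvex.AbsConvexOpen
import Mathlib.Analysis.Real.Sqrt
import Mathlib.Analysis.Convex.Cone.Extension
import Literature.Analysis.FunctionSpaces.Minlos
import Literature.Analysis.FunctionSpaces.MinlosSazonovBound
import Literature.Analysis.FunctionSpaces.BochnerProofs
import Literature.Probability.Process.KolmogorovExtension
import Literature.Probability.Process.KolmogorovExtensionProofs
import HarnessLib

/-!
# Minlos' theorem: proofs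

Proofs for the named fact `Literature.Analysis.FunctionSpaces.minlos` of `Literature/Analysis/FunctionSpaces/Minlos.lean`
(Minlos 1959; Gel'fand–Vilenkin IV, Ch. IV §4.2 Thm 2), following the Kolmogorov–Bochner–Minlos
architecture of Y. Yamasaki, *Measures on infinite dimensional spaces* (World Scientific 1985),
Part A, Ch. 3, §§15–20, which proves the theorem for an *arbitrary* nuclear space (Thm 20.1 (a),
no metrisability or separability), matching the generality of `Literature.Analysis.FunctionSpaces.minlos`.

Main results of this file: `Literature.minlos_holds : minlos V`, the discharge of the named fact, obtained
from `Literature.Analysis.FunctionSpaces.minlos_of_bochner_of_kolmogorov` — Minlos' theorem `minlos V` follows from the two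
classical finite-dimensional/measure-theoretic inputs, which are separate named facts of the
Literature tree, discharged in `…/FunctionSpaces/BochnerProofs.lean`
(`IsPositiveDefinite.exists_charFun_eq_holds`) and `…/Process/KolmogorovExtensionProofs.lean`
(`exists_isProjectiveLimit_holds`); and `Literature.Analysis.FunctionSpaces.isCharacteristicFunctionalOn_genFunctionalOf_holds`, the
discharge of the converse fact (generating functionals of probability measures are
characteristic functionals, for first countable `V`). The two inputs of the reduction:

* Bochner's theorem on the Euclidean spaces `ℝ^I`, `I : Finset V`
  (`Literature.Analysis.FunctionSpaces.IsPositiveDefinite.exists_charFun_eq`, `…/FunctionSpaces/NuclearSpace.lean`;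
  Yamasaki Part A Thm 16.1), and
* the Kolmogorov extension theorem for `ℝ^V`
  (`Literature.Probability.Process.exists_isProjectiveLimit`, `Literature/Probability/Process/KolmogorovExtension.lean`;
  Yamasaki Part A Thm 15.1).

## Architecture (Yamasaki 1985, Part A, Ch. 3)

* (U) *Uniqueness* `Literature.Analysis.FunctionSpaces.ext_of_genFunctionalOf_eq`: the cylinder σ-algebra is generated by the
  π-system of measurable cylinders, and the finite-dimensional marginals on `ℝ^I` are determined
  by their characteristic functions (Mathlib `Measure.ext_of_charFun`). Yamasaki §16, Thm 16.2
  (one-to-one correspondence).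
* (N) *Nuclear structure* `Literature.Analysis.FunctionSpaces.MinlosProof.exists_minlosData`: continuity of `C` at `0` gives a
  continuous seminorm `p` with `1 - Re C(f) ≤ ε + 2 p(f)²`; two applications of nuclearity
  (Pietsch form, `Literature.Analysis.FunctionSpaces.NuclearSpace`) give Hilbert–Schmidt dominations `p² ≤ ∑ φₙ²`,
  `φₙ² ≤ bₙ² ∑ₘ ψₘ²`, `∑ bₙ² < ∞`, `(∑ₘ ψₘ²)^{1/2}` continuous. Yamasaki Appendix, Lemma A.1′
  and §18, Def. 18.1 (the "HS" order of Hilbertian seminorms).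
* (K) *Kolmogorov measure of `C`* `Literature.Analysis.FunctionSpaces.MinlosProof.exists_measure_charFun_evalVec`: by Bochner
  the restrictions of `C` to finite-dimensional coordinate subspaces are characteristic functions
  of a projective family; its Kolmogorov limit `μ₀` on `V → ℝ` (all real functions, product
  σ-algebra) satisfies `∫ e^{i ∑ tₖ ω(xₖ)} dμ₀ = C (∑ tₖ xₖ)`. Yamasaki §15 Thm 15.1, §16 Thm 16.2.
* (A) *The topological dual is thick* `Literature.Analysis.FunctionSpaces.MinlosProof.measure_eq_one_of_forall_clm_mem`: every
  product-measurable set containing all continuous linear functionals has `μ₀`-measure one.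
  A measurable set depends on countably many coordinates `S`; the set `A_R` of functions whose
  rational finite combinations over `S` are bounded by `R q` lies inside it by Hahn–Banach
  (`exists_extension_of_le_sublinear`), and `μ₀ (A_Rᶜ) ≤ (ε + 2 ∑bₙ²/R²)/(1 - e^{-1/2})` by the
  finite-dimensional Minlos–Sazonov estimate `Literature.Analysis.FunctionSpaces.MinlosSazonov.measure_setOf_sq_inner_gt_le`
  (`…/MinlosSazonovBound.lean`) applied to the marginals of `μ₀` with the Gram matrices of `ψ`.
  Yamasaki §17 Thm 17.1, §18 Thm 18.2, §20 Thm 20.1 (a).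
* *Trace* `Literature.Analysis.FunctionSpaces.MinlosProof.exists_measure_map_eq_of_thick`: a finite measure for which the range
  of a map `ι` with induced σ-algebra is thick is the image of a measure along `ι`. Yamasaki §15,
  Thm 15.2 ("`μ` extends to `X` iff `X` is thick"). Applied to `ι : V' → (V → ℝ)`, whose induced
  σ-algebra is the cylinder σ-algebra (`dualCylinderSigma_eq_comap_pi`).

## References

* Y. Yamasaki, *Measures on infinite dimensional spaces*, World Scientific (1985), Part A,
  Ch. 3: Thm 15.1, Thm 15.2, Thm 16.1, Thm 16.2, Thm 17.1, Thm 18.2, Def. 20.1, Thm 20.1;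
  Appendix, Lemma A.1′.
* R. A. Minlos, *Generalized random processes and their extension to a measure*, Trudy Moskov.
  Mat. Obšč. 8 (1959), 497–518.
* I. M. Gel'fand, N. Ya. Vilenkin, *Generalized Functions IV* (1964), Ch. IV §2 Thm 2, §4.2
  Thm 2.

## Design

The file is proof-only (no definitions): the finite-dimensional coordinate maps are written as
the explicit lambdas `ω ↦ toLp 2 (k ↦ ω (x k)) : ℝ^κ` (Euclidean, so that Mathlib's `charFun` and
`Measure.ext_of_charFun` apply), the Hilbertian seminorm `(∑ₘ ψₘ²)^{1/2}` is produced
existentially (`MinlosProof.exists_sqSumSeminorm`), and, since no `MeasurableSpace` instance is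
registered on the weak-* dual (see `Minlos.lean`), the uniqueness section takes an arbitrary
measurable structure `‹_›` on it with the hypothesis `‹_› = dualCylinderSigma V` and is applied
under `letI := dualCylinderSigma V`.

## Mathlib

Used: `Measure.ext_of_charFun`, `measurableCylinders` / `generateFrom_measurableCylinders`,
`ext_of_generate_finite`, `MeasurableSet.eq_preimage_restrict_countable` (countable coordinate
dependence), `exists_extension_of_le_sublinear` (Hahn–Banach), `DenseRange.piMap`,
`with_gaugeSeminormFamily` (local convexity in seminorm form), `IsProjectiveMeasureFamily`,
`IsProjectiveLimit`, `Measure.ofMeasurable`.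
-/

namespace Literature.Analysis.FunctionSpaces

section Uniqueness

open scoped ComplexConjugate NNReal
open MeasureTheory Filter Topology Complex TopologicalSpace

/- No `MeasurableSpace` instance is registered on the weak-* dual (see `Minlos.lean`, Design); the
statements of this section take an arbitrary measurable structure `‹_›` on it together with the
hypothesis `hm : ‹_› = dualCylinderSigma V`, and are applied with `letI := dualCylinderSigma V`. -/
variable {V : Type*} [AddCommGroup V] [Module ℝ V] [TopologicalSpace V]
  [MeasurableSpace (V →Lₚₜ[ℝ] ℝ)]

/-- Every evaluation is measurable for (a measurable structure equal to) the cylinder σ-algebra.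
[folklore] -/
theorem measurable_eval_of_eq_dualCylinderSigma
    (hm : ‹MeasurableSpace (V →Lₚₜ[ℝ] ℝ)› = dualCylinderSigma V) (f : V) :
    Measurable fun ω : V →Lₚₜ[ℝ] ℝ => ω f := by
  rw [hm]
  exact measurable_eval_dualCylinderSigma f

/-- The marginal map `ω ↦ (ω (x k))ₖ ∈ ℝ^ι` of the weak-* dual along a countable family `x` is
measurable for the cylinder σ-algebra (each coordinate is an evaluation). [folklore] -/
theorem measurable_dualEval (hm : ‹MeasurableSpace (V →Lₚₜ[ℝ] ℝ)› = dualCylinderSigma V)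
    {ι : Type*} [Countable ι] (x : ι → V) :
    Measurable (fun ω : V →Lₚₜ[ℝ] ℝ => (WithLp.toLp 2 fun k => ω (x k) : EuclideanSpace ℝ ι)) :=
  (WithLp.measurable_toLp 2 _).comp
    (measurable_pi_lambda _ fun k => measurable_eval_of_eq_dualCylinderSigma hm (x k))

omit [MeasurableSpace (V →Lₚₜ[ℝ] ℝ)] in
/-- `⟪(ω (x k))ₖ, t⟫ = ω (∑ₖ tₖ xₖ)`. [folklore] -/
theorem inner_dualEval {ι : Type*} [Fintype ι] (x : ι → V) (ω : V →Lₚₜ[ℝ] ℝ)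
    (t : EuclideanSpace ℝ ι) :
    @inner ℝ _ _ (WithLp.toLp 2 fun k => ω (x k) : EuclideanSpace ℝ ι) t = ω (∑ k, t k • x k) := by
  simp [PiLp.inner_apply, map_sum, map_smul]

/-- The characteristic function of the marginal of `μ` along `x` is the generating functional of
`μ` on the span: `(μ ∘ dualEval x⁻¹)^(t) = ∫ e^{i ω(∑ tₖ xₖ)} dμ`. Yamasaki 1985, Part A §16,
proof of Thm 16.2. [cite: Yamasaki1985, Part A §16, Thm 16.2 (proof)] -/
theorem charFun_map_dualEval (hm : ‹MeasurableSpace (V →Lₚₜ[ℝ] ℝ)› = dualCylinderSigma V)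
    {ι : Type*} [Fintype ι] (x : ι → V) (μ : Measure (V →Lₚₜ[ℝ] ℝ)) (t : EuclideanSpace ℝ ι) :
    charFun (μ.map (fun ω : V →Lₚₜ[ℝ] ℝ =>
      (WithLp.toLp 2 fun k => ω (x k) : EuclideanSpace ℝ ι))) t =
      genFunctionalOf μ (∑ k, t k • x k) := by
  rw [charFun_apply, integral_map (measurable_dualEval hm x).aemeasurable (by fun_prop)]
  simp only [genFunctionalOf]
  refine integral_congr_ae (Eventually.of_forall fun ω => ?_)
  dsimp only
  rw [inner_dualEval x ω t, mul_comm]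

/-- **Uniqueness in Minlos' theorem** on the cylinder σ-algebra: two finite measures on the
weak-* dual `V'` (cylinder σ-algebra `dualCylinderSigma V`) with the same generating functional
coincide — the finite-dimensional marginals agree by `Measure.ext_of_charFun`, and the measurable
cylinders form a generating π-system. No hypothesis on `V` beyond being a topological vector
space. Yamasaki 1985, Part A §16, Thm 16.2 (injectivity of `μ ↦ χ`); Gel'fand–Vilenkin IV,
Ch. IV §4.1. [cite: Yamasaki1985, Part A §16, Thm 16.2] -/
theorem ext_of_genFunctionalOf_eq (hm : ‹MeasurableSpace (V →Lₚₜ[ℝ] ℝ)› = dualCylinderSigma V)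
    {μ ν : Measure (V →Lₚₜ[ℝ] ℝ)} [IsFiniteMeasure μ] [IsFiniteMeasure ν]
    (h : ∀ f, genFunctionalOf μ f = genFunctionalOf ν f) : μ = ν := by
  -- finite-dimensional marginals agree
  have hmap : ∀ I : Finset V,
      μ.map (fun (ω : V →Lₚₜ[ℝ] ℝ) (i : I) => ω i) = ν.map fun (ω : V →Lₚₜ[ℝ] ℝ) (i : I) => ω i := by
    intro I
    have hE : μ.map (fun ω : V →Lₚₜ[ℝ] ℝ =>
          (WithLp.toLp 2 fun k : I => ω ((Subtype.val : I → V) k) : EuclideanSpace ℝ I)) =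
        ν.map (fun ω : V →Lₚₜ[ℝ] ℝ =>
          (WithLp.toLp 2 fun k : I => ω ((Subtype.val : I → V) k) : EuclideanSpace ℝ I)) :=
      Measure.ext_of_charFun (funext fun t => by
        rw [charFun_map_dualEval hm Subtype.val, charFun_map_dualEval hm Subtype.val, h])
    have hcomp : (fun (ω : V →Lₚₜ[ℝ] ℝ) (i : I) => ω i) = WithLp.ofLp ∘ (fun ω : V →Lₚₜ[ℝ] ℝ =>
        (WithLp.toLp 2 fun k : I => ω ((Subtype.val : I → V) k) : EuclideanSpace ℝ I)) := rfl
    rw [hcomp, ← Measure.map_map (WithLp.measurable_ofLp 2 _) (measurable_dualEval hm _),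
      ← Measure.map_map (WithLp.measurable_ofLp 2 _) (measurable_dualEval hm _), hE]
  have huniv : μ Set.univ = ν Set.univ := by
    have h0 := h 0
    simp only [genFunctionalOf, map_zero, ofReal_zero, mul_zero, Complex.exp_zero,
      integral_const, Measure.real, real_smul, mul_one, Complex.ofReal_inj] at h0
    exact (ENNReal.toReal_eq_toReal_iff' (measure_ne_top μ _) (measure_ne_top ν _)).1 h0
  refine ext_of_generate_finite
    { s | ∃ t ∈ measurableCylinders (fun _ : V => ℝ), (fun ω : V →Lₚₜ[ℝ] ℝ => (⇑ω : V → ℝ)) ⁻¹' t = s }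
    ?_ (isPiSystem_measurableCylinders.comap _) ?_ huniv
  · rw [hm, dualCylinderSigma_eq_comap_pi, ← generateFrom_measurableCylinders,
      MeasurableSpace.comap_generateFrom]
    rfl
  · rintro _ ⟨t, ht, rfl⟩
    obtain ⟨I, S, hS, rfl⟩ := (mem_measurableCylinders t).1 ht
    have hmeas : Measurable fun (ω : V →Lₚₜ[ℝ] ℝ) (i : I) => ω i :=
      measurable_pi_lambda _ fun i => measurable_eval_of_eq_dualCylinderSigma hm (i : V)
    have h1 : (fun ω : V →Lₚₜ[ℝ] ℝ => (⇑ω : V → ℝ)) ⁻¹' cylinder I S =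
        (fun (ω : V →Lₚₜ[ℝ] ℝ) (i : I) => ω i) ⁻¹' S := rfl
    rw [h1, ← Measure.map_apply hmeas hS, ← Measure.map_apply hmeas hS, hmap I]

end Uniqueness

section Nuclear

open scoped ComplexConjugate NNReal
open MeasureTheory Filter Topology Complex TopologicalSpace

namespace MinlosProof

/-! ### Discrete Cauchy–Schwarz and the `ℓ²`-seminorm of a family of functionals -/

/-- Discrete Cauchy–Schwarz for square-summable nonnegative sequences:
`∑ uₙ vₙ ≤ (∑ uₙ²)^{1/2} (∑ vₙ²)^{1/2}` (and the left side is summable). [folklore] -/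
theorem tsum_mul_le_sqrt_mul_sqrt {u v : ℕ → ℝ} (hu0 : ∀ n, 0 ≤ u n) (hv0 : ∀ n, 0 ≤ v n)
    (hu : Summable fun n => u n ^ 2) (hv : Summable fun n => v n ^ 2) :
    Summable (fun n => u n * v n) ∧
      ∑' n, u n * v n ≤ Real.sqrt (∑' n, u n ^ 2) * Real.sqrt (∑' n, v n ^ 2) := by
  have hs : Summable fun n => u n * v n := by
    refine Summable.of_nonneg_of_le (fun n => mul_nonneg (hu0 n) (hv0 n)) (fun n => ?_)
      ((hu.add hv).div_const 2)
    nlinarith [sq_nonneg (u n - v n)]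
  refine ⟨hs, hs.tsum_le_of_sum_le fun s => ?_⟩
  calc ∑ n ∈ s, u n * v n ≤ √(∑ n ∈ s, u n ^ 2) * √(∑ n ∈ s, v n ^ 2) :=
        Real.sum_mul_le_sqrt_mul_sqrt s u v
    _ ≤ √(∑' n, u n ^ 2) * √(∑' n, v n ^ 2) := by
        gcongr
        · exact hu.sum_le_tsum s fun n _ => sq_nonneg _
        · exact hv.sum_le_tsum s fun n _ => sq_nonneg _

/-- Discrete Cauchy–Schwarz, signed version: for square-summable `u, v` the products `uₙ vₙ` are
summable and `∑ uₙ vₙ ≤ (∑ uₙ²)^{1/2} (∑ vₙ²)^{1/2}`. [folklore] -/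
theorem tsum_mul_le_of_sq {u v : ℕ → ℝ} (hu : Summable fun n => u n ^ 2)
    (hv : Summable fun n => v n ^ 2) :
    Summable (fun n => u n * v n) ∧
      ∑' n, u n * v n ≤ Real.sqrt (∑' n, u n ^ 2) * Real.sqrt (∑' n, v n ^ 2) := by
  obtain ⟨hs, hle⟩ := tsum_mul_le_sqrt_mul_sqrt (fun n => abs_nonneg (u n)) (fun n => abs_nonneg (v n))
    (by simpa using hu) (by simpa using hv)
  have hs' : Summable fun n => u n * v n :=
    .of_norm (by simpa [abs_mul] using hs)
  refine ⟨hs', ?_⟩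
  calc ∑' n, u n * v n ≤ ∑' n, |u n| * |v n| :=
        hs'.tsum_le_tsum (fun n => by rw [← abs_mul]; exact le_abs_self _) hs
    _ ≤ _ := by simpa using hle

variable {V : Type*} [AddCommGroup V] [Module ℝ V]

/-- **The Hilbertian seminorm of a square-summable family of functionals.** For a pointwise
square-summable sequence of linear functionals `ψₘ` there is a seminorm `q` with
`q(f) = (∑ₘ ψₘ(f)²)^{1/2}` (subadditivity by the discrete Cauchy–Schwarz inequality).
Yamasaki 1985, Appendix, Lemma A.1′ (the seminorms `‖x‖_{0H}`, `‖x‖_{1H}`). [cite: Yamasaki1985, Appendix, Lemma A.1′] -/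
theorem exists_sqSumSeminorm (ψ : ℕ → V →ₗ[ℝ] ℝ) (hψ : ∀ f, Summable fun m => ψ m f ^ 2) :
    ∃ q : Seminorm ℝ V, ∀ f, q f = Real.sqrt (∑' m, ψ m f ^ 2) := by
  refine ⟨Seminorm.of (fun f => Real.sqrt (∑' m, ψ m f ^ 2)) (fun f g => ?_) (fun a f => ?_),
    fun f => rfl⟩
  · have hf := hψ f
    have hg := hψ g
    obtain ⟨hs, hle⟩ := tsum_mul_le_of_sq hf hg
    have hA : √(∑' m, ψ m f ^ 2) ^ 2 = ∑' m, ψ m f ^ 2 :=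
      Real.sq_sqrt (tsum_nonneg fun m => sq_nonneg (ψ m f))
    have hB : √(∑' m, ψ m g ^ 2) ^ 2 = ∑' m, ψ m g ^ 2 :=
      Real.sq_sqrt (tsum_nonneg fun m => sq_nonneg (ψ m g))
    rw [Real.sqrt_le_iff]
    refine ⟨by positivity, ?_⟩
    have hexp : ∀ m, ψ m (f + g) ^ 2 = (ψ m f ^ 2 + 2 * (ψ m f * ψ m g)) + ψ m g ^ 2 :=
      fun m => by rw [map_add]; ring
    simp_rw [hexp]
    rw [(hf.add (hs.mul_left 2)).tsum_add hg, hf.tsum_add (hs.mul_left 2), tsum_mul_left]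
    nlinarith [hle, hA, hB, Real.sqrt_nonneg (∑' m, ψ m f ^ 2),
      Real.sqrt_nonneg (∑' m, ψ m g ^ 2)]
  · simp_rw [map_smul, smul_eq_mul, mul_pow, tsum_mul_left, Real.sqrt_mul (sq_nonneg a),
      Real.sqrt_sq_eq_abs, Real.norm_eq_abs]

/-! ### Positive-definite functions: the bound `1 - Re C(f) ≤ 2` -/

omit [Module ℝ V] in
/-- For a positive-definite `C` with `C 0 = 1` one has `Re C(f) ≥ -1`, i.e. `1 - Re C(f) ≤ 2`
(the `2 × 2` case of positive definiteness with coefficient vectors `(1, 1)` and `(1, i)`).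
[folklore] -/
theorem one_sub_re_le_two {C : V → ℂ} (hC : IsPositiveDefinite C) (h0 : C 0 = 1) (f : V) :
    1 - (C f).re ≤ 2 := by
  have h1 := (hC 2 ![0, f] ![1, 1]).1
  have h2 := (hC 2 ![0, f] ![1, I]).2
  simp [Fin.sum_univ_two, h0] at h1 h2
  linarith

/-! ### Continuity of `C` at `0` in seminorm form -/

variable [TopologicalSpace V] [IsTopologicalAddGroup V] [ContinuousSMul ℝ V]

/-- Continuity of a characteristic functional at `0` in seminorm form: on a locally convex space,
for every `ε > 0` there is a continuous seminorm `p` with `1 - Re C(f) ≤ ε + 2 p(f)²` for all `f`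
(inside the `p`-unit ball by continuity, outside by `1 - Re C ≤ 2 ≤ 2 p²`). Yamasaki 1985,
Part A §17, proof of Thm 17.1, the estimate preceding (17.3) (`‖x‖₁ < 1 ⇒ |χ(x) - 1| < ε`).
[cite: Yamasaki1985, Part A §17, Thm 17.1 (proof)] -/
theorem exists_seminorm_re_bound [LocallyConvexSpace ℝ V] {C : V → ℂ}
    (hC : IsCharacteristicFunctionalOn C) {ε : ℝ} (hε : 0 < ε) :
    ∃ p : Seminorm ℝ V, Continuous p ∧ ∀ f, 1 - (C f).re ≤ ε + 2 * p f ^ 2 := by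
  obtain ⟨h0, hcont, hpd⟩ := hC
  set U : Set V := C ⁻¹' Metric.ball (C 0) ε with hU_def
  have hU : U ∈ 𝓝 (0 : V) := hcont.continuousAt.preimage_mem_nhds (Metric.ball_mem_nhds _ hε)
  have hW := with_gaugeSeminormFamily (𝕜 := ℝ) (E := V)
  obtain ⟨s, r, hr, hball⟩ := (hW.mem_nhds_iff 0 U).1 hU
  set p₀ : Seminorm ℝ V := s.sup (gaugeSeminormFamily ℝ V) with hp₀
  have hp₀c : Continuous p₀ := by
    refine Seminorm.continuous (r := 1) ?_
    exact (hW.mem_nhds_iff 0 _).2 ⟨s, 1, one_pos, subset_rfl⟩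
  set a : ℝ≥0 := ⟨r⁻¹, by positivity⟩ with ha
  have hpf : ∀ f, (a • p₀) f = r⁻¹ * p₀ f := fun f => by
    rw [smul_apply, NNReal.smul_def, smul_eq_mul]
    rfl
  refine ⟨a • p₀, ?_, fun f => ?_⟩
  · have : ⇑(a • p₀) = fun f => r⁻¹ * p₀ f := funext hpf
    rw [this]
    exact continuous_const.mul hp₀c
  · rcases lt_or_ge ((a • p₀) f) 1 with hlt | hge
    · have hf : f ∈ U := by
        apply hball
        rw [Seminorm.mem_ball_zero]
        rw [hpf, inv_mul_lt_iff₀ hr, mul_one] at hlt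
        exact hlt
      have hdist : dist (C f) (C 0) < ε := hf
      rw [h0, Complex.dist_eq] at hdist
      have : 1 - (C f).re ≤ ‖C f - 1‖ := by
        have := Complex.abs_re_le_norm (C f - 1)
        rw [Complex.sub_re, Complex.one_re] at this
        linarith [neg_abs_le ((C f).re - 1)]
      nlinarith [sq_nonneg ((a • p₀) f)]
    · have := one_sub_re_le_two hpd h0 f
      nlinarith

/-! ### Nuclearity in Hilbert–Schmidt form -/

omit [IsTopologicalAddGroup V] [ContinuousSMul ℝ V] in
/-- **Nuclearity in Hilbert–Schmidt form.** From Pietsch's form of nuclearity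
(`Literature.Analysis.FunctionSpaces.NuclearSpace`): every continuous seminorm `p` satisfies `p(f)² ≤ ∑ₙ φₙ(f)²` with
continuous linear `φₙ`, `φₙ(f)² ≤ S cₙ q(f)²` for a continuous seminorm `q`, `cₙ > 0`,
`∑ cₙ = S < ∞` (Cauchy–Schwarz: `(∑ |φ'ₙ f|)² ≤ (∑ cₙ)(∑ φ'ₙ(f)²/cₙ)`). This is the passage from
nuclear to Hilbert–Schmidt-related Hilbertian seminorms of Yamasaki 1985, Appendix, Lemma A.1′.
[cite: Yamasaki1985, Appendix, Lemma A.1′] -/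
theorem exists_sqSum_dominating [NuclearSpace ℝ V] (p : Seminorm ℝ V) (hp : Continuous p) :
    ∃ (φ : ℕ → V →L[ℝ] ℝ) (c : ℕ → ℝ) (q : Seminorm ℝ V), Continuous q ∧ (∀ n, 0 < c n) ∧
      Summable c ∧ (∀ n f, φ n f ^ 2 ≤ (∑' k, c k) * c n * q f ^ 2) ∧
      (∀ f, Summable fun n => φ n f ^ 2) ∧ ∀ f, p f ^ 2 ≤ ∑' n, φ n f ^ 2 := by
  obtain ⟨q, hq, φ', c', hc', hφ', -, hpφ⟩ := NuclearSpace.exists_dominating (𝕜 := ℝ) p hp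
  set c : ℕ → ℝ := fun n => (c' n : ℝ) + (1 / 2) ^ n with hc_def
  have hc0 : ∀ n, 0 < c n := fun n => by positivity
  have hcc' : ∀ n, (c' n : ℝ) ≤ c n := fun n => le_add_of_nonneg_right (by positivity)
  have hcs : Summable c :=
    (NNReal.summable_coe.2 hc').add (summable_geometric_of_lt_one (by norm_num) (by norm_num))
  set S : ℝ := ∑' n, c n with hS_def
  have hS0 : 0 < S := hcs.tsum_pos (fun n => (hc0 n).le) 0 (hc0 0)
  set φ : ℕ → V →L[ℝ] ℝ := fun n => Real.sqrt (S / c n) • φ' n with hφ_def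
  have hφ_apply : ∀ n f, φ n f ^ 2 = S / c n * φ' n f ^ 2 := fun n f => by
    simp only [hφ_def, FunLike.coe_smul, Pi.smul_apply, smul_eq_mul, mul_pow]
    rw [Real.sq_sqrt (by positivity)]
  have hdom : ∀ n f, φ n f ^ 2 ≤ S * c n * q f ^ 2 := fun n f => by
    rw [hφ_apply]
    have h1 : φ' n f ^ 2 ≤ (c n * q f) ^ 2 := by
      have := hφ' n f
      rw [Real.norm_eq_abs] at this
      have h2 : |φ' n f| ≤ c n * q f :=
        this.trans (mul_le_mul_of_nonneg_right (hcc' n) (apply_nonneg q f))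
      exact sq_le_sq' (by linarith [neg_abs_le (φ' n f)]) (le_abs_self _ |>.trans h2)
    calc S / c n * φ' n f ^ 2 ≤ S / c n * (c n * q f) ^ 2 := by gcongr
      _ = S * c n * q f ^ 2 := by field_simp
  have hsumφ : ∀ f, Summable fun n => φ n f ^ 2 := fun f =>
    Summable.of_nonneg_of_le (fun n => sq_nonneg _) (fun n => hdom n f)
      ((hcs.mul_left S).mul_right (q f ^ 2))
  refine ⟨φ, c, q, hq, hc0, hcs, hdom, hsumφ, fun f => ?_⟩
  -- Cauchy–Schwarz: `(∑ |φ'ₙ f|)² ≤ (∑ cₙ) (∑ φ'ₙ(f)²/cₙ) = ∑ φₙ(f)²`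
  set u : ℕ → ℝ := fun n => Real.sqrt (c n)
  set v : ℕ → ℝ := fun n => |φ' n f| / Real.sqrt (c n)
  have huv : ∀ n, u n * v n = ‖φ' n f‖ := fun n => by
    simp only [u, v, Real.norm_eq_abs]
    rw [mul_div_cancel₀ _ (Real.sqrt_pos.2 (hc0 n)).ne']
  have hu2 : ∀ n, u n ^ 2 = c n := fun n => Real.sq_sqrt (hc0 n).le
  have hv2 : ∀ n, v n ^ 2 = φ n f ^ 2 / S := fun n => by
    simp only [v]
    rw [div_pow, Real.sq_sqrt (hc0 n).le, sq_abs, hφ_apply]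
    field_simp
  obtain ⟨-, hle⟩ := tsum_mul_le_sqrt_mul_sqrt (u := u) (v := v) (fun n => Real.sqrt_nonneg _)
    (fun n => by positivity) (by simp_rw [hu2]; exact hcs)
    (by simp_rw [hv2]; exact (hsumφ f).div_const S)
  simp_rw [huv, hu2, hv2, tsum_div_const] at hle
  rw [← hS_def, ← Real.sqrt_mul hS0.le, mul_div_cancel₀ _ hS0.ne'] at hle
  have hp0 : 0 ≤ p f := apply_nonneg p f
  have h1 : p f ≤ Real.sqrt (∑' n, φ n f ^ 2) := (hpφ f).trans hle
  calc p f ^ 2 ≤ Real.sqrt (∑' n, φ n f ^ 2) ^ 2 := pow_le_pow_left₀ hp0 h1 2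
    _ = ∑' n, φ n f ^ 2 := Real.sq_sqrt (tsum_nonneg fun n => sq_nonneg _)

/-- **Minlos data.** For a characteristic functional `C` on a nuclear locally convex space and
`ε > 0`: continuous linear functionals `φₙ, ψₘ` and constants `bₙ` with
`1 - Re C(f) ≤ ε + 2 ∑ₙ φₙ(f)²`, `φₙ(f)² ≤ bₙ² ∑ₘ ψₘ(f)²`, `∑ bₙ² < ∞`, and
`f ↦ (∑ₘ ψₘ(f)²)^{1/2}` a continuous (Hilbertian) seminorm: continuity of `C`
(`exists_seminorm_re_bound`) followed by two applications of nuclearity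
(`exists_sqSum_dominating`). These are the hypotheses `‖·‖ ≺_{HS} ‖·‖₁`, `χ` continuous for
`‖·‖₁` of Yamasaki 1985, Part A §18, Thm 18.2, produced as in §20, Thm 20.1 (a).
[cite: Yamasaki1985, Part A §18 Thm 18.2 and §20 Thm 20.1 (a)] -/
theorem exists_minlosData [LocallyConvexSpace ℝ V] [NuclearSpace ℝ V] {C : V → ℂ}
    (hC : IsCharacteristicFunctionalOn C) {ε : ℝ} (hε : 0 < ε) :
    ∃ (φ ψ : ℕ → V →L[ℝ] ℝ) (b : ℕ → ℝ) (q : Seminorm ℝ V),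
      (∀ f, Summable fun m => ψ m f ^ 2) ∧
      Summable (fun n => b n ^ 2) ∧
      (∀ f, Summable fun n => φ n f ^ 2) ∧
      Continuous q ∧
      (∀ f, q f ^ 2 = ∑' m, ψ m f ^ 2) ∧
      (∀ n f, φ n f ^ 2 ≤ b n ^ 2 * ∑' m, ψ m f ^ 2) ∧
      (∀ f, 1 - (C f).re ≤ ε + 2 * ∑' n, φ n f ^ 2) := by
  obtain ⟨p, hp, hCp⟩ := exists_seminorm_re_bound hC hε
  obtain ⟨φ, c, q₁, hq₁, hc0, hcs, hdom, hsumφ, hpφ⟩ := exists_sqSum_dominating p hp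
  obtain ⟨ψ, d, q₂, hq₂, hd0, hds, hdom', hsumψ, hqψ⟩ := exists_sqSum_dominating q₁ hq₁
  have hψ : ∀ f, Summable fun m => (ψ m : V →ₗ[ℝ] ℝ) f ^ 2 := hsumψ
  obtain ⟨q, hq⟩ := exists_sqSumSeminorm (fun m => (ψ m : V →ₗ[ℝ] ℝ)) hψ
  refine ⟨φ, ψ, fun n => Real.sqrt ((∑' k, c k) * c n), q, hsumψ, ?_, hsumφ, ?_, fun f => ?_,
    fun n f => ?_, fun f => (hCp f).trans (by gcongr; exact hpφ f)⟩
  · have hS : 0 ≤ ∑' k, c k := tsum_nonneg fun k => (hc0 k).le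
    simp_rw [Real.sq_sqrt (mul_nonneg hS (hc0 _).le)]
    exact hcs.mul_left _
  · -- continuity: `sqSum ψ ≤ D · q₂`
    have hD : 0 ≤ ∑' k, d k := tsum_nonneg fun k => (hd0 k).le
    set D : ℝ≥0 := ⟨∑' k, d k, hD⟩ with hD_def
    have hDq : ∀ f, (D • q₂) f = (∑' k, d k) * q₂ f := fun f => by
      rw [smul_apply, NNReal.smul_def, smul_eq_mul]
      rfl
    have hcq : Continuous (D • q₂) := by
      have : ⇑(D • q₂) = fun f => (∑' k, d k) * q₂ f := funext hDq
      rw [this]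
      exact continuous_const.mul hq₂
    refine Seminorm.continuous_of_le hcq fun f => ?_
    rw [hDq, hq f]
    change Real.sqrt (∑' m, ψ m f ^ 2) ≤ (∑' k, d k) * q₂ f
    rw [Real.sqrt_le_iff]
    refine ⟨by positivity, ?_⟩
    calc ∑' m, ψ m f ^ 2 ≤ ∑' m, (∑' k, d k) * d m * q₂ f ^ 2 :=
          (hsumψ f).tsum_le_tsum (fun m => hdom' m f) ((hds.mul_left _).mul_right _)
      _ = ((∑' k, d k) * q₂ f) ^ 2 := by
          rw [tsum_mul_right, tsum_mul_left]; ring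
  · rw [hq f]
    exact Real.sq_sqrt (tsum_nonneg fun _ => sq_nonneg _)
  · have hS : 0 ≤ ∑' k, c k := tsum_nonneg fun k => (hc0 k).le
    rw [Real.sq_sqrt (mul_nonneg hS (hc0 _).le)]
    calc φ n f ^ 2 ≤ (∑' k, c k) * c n * q₁ f ^ 2 := hdom n f
      _ ≤ (∑' k, c k) * c n * ∑' m, ψ m f ^ 2 :=
          mul_le_mul_of_nonneg_left (hqψ f) (mul_nonneg hS (hc0 n).le)

end MinlosProof

end Nuclear

section Kolmogorov

open scoped ComplexConjugate NNReal ENNReal RealInnerProductSpace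
open MeasureTheory Filter Topology Complex TopologicalSpace WithLp

namespace MinlosProof

/-! ### A reindexing identity for finite sums -/

/-- Reindexing identity `∑ᵢ (∑ₖ [x k = i] tₖ) • Gᵢ = ∑ₖ tₖ • G (x k)` (push-forward of a
coefficient vector along `x : κ → ι`). [folklore] -/
theorem sum_ite_smul_eq {ι κ M : Type*} [Fintype ι] [Fintype κ] [DecidableEq ι] [AddCommMonoid M]
    [Module ℝ M] (x : κ → ι) (t : κ → ℝ) (G : ι → M) :
    ∑ i, (∑ k, if x k = i then t k else 0) • G i = ∑ k, t k • G (x k) := by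
  simp_rw [Finset.sum_smul, ite_smul, zero_smul]
  rw [Finset.sum_comm]
  simp [Finset.sum_ite_eq]

/-! ### Trace of a finite measure on a thick subset -/

/-- **Trace of a measure on a thick subset.** Let `ι : Y → X`, where the σ-algebra of `Y` is
induced from that of `X` along `ι` (`hsurj`), and let `μ₀` be a finite measure on `X` for which
the range of `ι` is *thick*: every measurable set containing it has full measure. Then `μ₀` is
the image under `ι` of a measure on `Y` (namely `μ (ι ⁻¹' E) := μ₀ E`, well defined by
thickness). Yamasaki 1985, Part A §15, Thm 15.2 (a measure on `E^a` extends to `X ⊆ E^a` iff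
`X` is thick; the "trace" of `μ` on `X`). [cite: Yamasaki1985, Part A §15, Thm 15.2] -/
theorem exists_measure_map_eq_of_thick {X Y : Type*} [MeasurableSpace X] [MeasurableSpace Y]
    (μ₀ : Measure X) [IsFiniteMeasure μ₀] {ι : Y → X} (hι : Measurable ι)
    (hsurj : ∀ s : Set Y, MeasurableSet s → ∃ E, MeasurableSet E ∧ ι ⁻¹' E = s)
    (hthick : ∀ E, MeasurableSet E → Set.range ι ⊆ E → μ₀ E = μ₀ Set.univ) :
    ∃ μ : Measure Y, μ.map ι = μ₀ := by
  classical
  -- a measurable set whose preimage is empty is null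
  have hnull : ∀ E, MeasurableSet E → ι ⁻¹' E = ∅ → μ₀ E = 0 := by
    intro E hE hpre
    have h1 : Set.range ι ⊆ Eᶜ := by
      rintro _ ⟨y, rfl⟩ hy
      have : y ∈ ι ⁻¹' E := hy
      rw [hpre] at this
      exact this
    have h2 := hthick Eᶜ hE.compl h1
    have h3 := measure_add_measure_compl (μ := μ₀) hE
    rw [h2] at h3
    exact (ENNReal.add_left_inj (measure_ne_top μ₀ _)).1 (h3.trans (zero_add _).symm)
  -- two measurable sets with the same preimage have the same measure
  have hcongr : ∀ E E', MeasurableSet E → MeasurableSet E' → ι ⁻¹' E = ι ⁻¹' E' →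
      μ₀ E = μ₀ E' := by
    intro E E' hE hE' h
    have h1 : μ₀ (E \ E') = 0 :=
      hnull _ (hE.diff hE') (by rw [Set.preimage_sdiff, h, Set.sdiff_self])
    have h2 : μ₀ (E' \ E) = 0 :=
      hnull _ (hE'.diff hE) (by rw [Set.preimage_sdiff, h, Set.sdiff_self])
    exact measure_congr (ae_eq_set.2 ⟨h1, h2⟩)
  choose! rep hrep_meas hrep_pre using hsurj
  refine ⟨Measure.ofMeasurable (fun s _ => μ₀ (rep s)) ?_ ?_, ?_⟩
  · exact hnull _ (hrep_meas ∅ MeasurableSet.empty) (hrep_pre ∅ MeasurableSet.empty)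
  · intro f hf hdisj
    rw [hcongr (rep (⋃ i, f i)) (⋃ i, rep (f i)) (hrep_meas _ (MeasurableSet.iUnion hf))
      (MeasurableSet.iUnion fun i => hrep_meas _ (hf i)) ?_]
    · refine measure_iUnion₀ ?_ (fun i => (hrep_meas _ (hf i)).nullMeasurableSet)
      intro i j hij
      change μ₀ (rep (f i) ∩ rep (f j)) = 0
      refine hnull _ ((hrep_meas _ (hf i)).inter (hrep_meas _ (hf j))) ?_
      rw [Set.preimage_inter, hrep_pre _ (hf i), hrep_pre _ (hf j)]
      exact Set.disjoint_iff_inter_eq_empty.1 (hdisj hij)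
    · rw [hrep_pre _ (MeasurableSet.iUnion hf), Set.preimage_iUnion]
      exact Set.iUnion_congr fun i => (hrep_pre _ (hf i)).symm
  · ext E hE
    rw [Measure.map_apply hι hE, Measure.ofMeasurable_apply _ (hι hE)]
    exact hcongr _ _ (hrep_meas _ (hι hE)) hE (hrep_pre _ (hι hE))

/-! ### Evaluation vectors on the space of all functions `V → ℝ` -/

variable {V : Type*}

/-- The vector of evaluations `ω ↦ (ω (x k))ₖ ∈ ℝ^κ` (Euclidean) along a finite family
`x : κ → V` of an arbitrary function `ω : V → ℝ` (cylinder coordinates on `ℝ^V ⊇ V^a ⊇ V'`,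
Yamasaki 1985, Part A §15) is measurable for the product σ-algebra. [folklore] -/
theorem measurable_evalVec {κ : Type*} [Fintype κ] (x : κ → V) :
    Measurable (fun ω : V → ℝ => (toLp 2 fun k => ω (x k) : EuclideanSpace ℝ κ)) :=
  (WithLp.measurable_toLp 2 _).comp (measurable_pi_lambda _ fun k => measurable_pi_apply (x k))

/-- `⟪(ω (x k))ₖ, t⟫ = ∑ₖ tₖ ω(xₖ)`. [folklore] -/
theorem inner_evalVec {κ : Type*} [Fintype κ] (x : κ → V) (ω : V → ℝ)
    (t : EuclideanSpace ℝ κ) :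
    ⟪(toLp 2 fun k => ω (x k) : EuclideanSpace ℝ κ), t⟫ = ∑ k, t k * ω (x k) := by
  simp [PiLp.inner_apply, mul_comm]

/-! ### The finite-dimensional distributions (Bochner + Kolmogorov) -/

variable [AddCommGroup V] [Module ℝ V] [TopologicalSpace V] [IsTopologicalAddGroup V]
  [ContinuousSMul ℝ V]

/-- **The Kolmogorov measure of a characteristic functional.** Given Bochner's theorem on the
Euclidean spaces `ℝ^I`, `I : Finset V`, and the Kolmogorov extension theorem for `ℝ^V`, a
characteristic functional `C` on `V` is the "Fourier transform" of a probability measure `μ₀`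
on the space `V → ℝ` of *all* real functions on `V` (product σ-algebra): the law under `μ₀` of
the evaluation vector `ω ↦ (ω i)_{i ∈ I}` has characteristic function `t ↦ C (∑ tᵢ • i)`.
The restrictions of `C` to the coordinate subspaces are continuous positive-definite, Bochner
gives probability measures `ν_I` on `ℝ^I`, uniqueness of characteristic functions makes them a
projective family, and Kolmogorov gives `μ₀`. Yamasaki 1985, Part A §15 Thm 15.1 and §16
Thm 16.2 (there on the algebraic dual `E^a`; here on the larger product `ℝ^E`, which suffices).
[cite: Yamasaki1985, Part A §15 Thm 15.1 and §16 Thm 16.2] -/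
theorem exists_measure_charFun_evalVec
    (hB : ∀ I : Finset V, IsPositiveDefinite.exists_charFun_eq (E := EuclideanSpace ℝ ↥I))
    (hK : Literature.Probability.Process.exists_isProjectiveLimit (ι := V) (α := fun _ => ℝ))
    {C : V → ℂ} (hC : IsCharacteristicFunctionalOn C) :
    ∃ μ₀ : Measure (V → ℝ), IsProbabilityMeasure μ₀ ∧
      ∀ (I : Finset V) (t : EuclideanSpace ℝ ↥I),
        charFun (μ₀.map (fun ω : V → ℝ => (toLp 2 fun i : ↥I => ω ((Subtype.val : ↥I → V) i) : EuclideanSpace ℝ ↥I))) t =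
          C (∑ i : ↥I, t i • (i : V)) := by
  classical
  obtain ⟨h0, hcont, hpd⟩ := hC
  -- the finite-dimensional restrictions of `C`
  set L : ∀ I : Finset V, EuclideanSpace ℝ ↥I →ₗ[ℝ] V := fun I =>
    (Fintype.linearCombination ℝ (fun i : ↥I => (i : V))) ∘ₗ
      (WithLp.linearEquiv 2 ℝ (↥I → ℝ)).toLinearMap with hL
  have hLap : ∀ (I : Finset V) (t : EuclideanSpace ℝ ↥I), L I t = ∑ i : ↥I, t i • (i : V) := by
    intro I t
    simp [hL, Fintype.linearCombination_apply]
  set CI : ∀ I : Finset V, EuclideanSpace ℝ ↥I → ℂ := fun I t => C (L I t) with hCI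
  have hpdI : ∀ I, IsPositiveDefinite (CI I) := by
    intro I n x c
    have := hpd n (fun k => L I (x k)) c
    simp only [← map_sub] at this
    simpa only [hCI] using this
  have hcontI : ∀ I, Continuous (CI I) := by
    intro I
    exact hcont.comp (L I).continuous_of_finiteDimensional
  have h0I : ∀ I, CI I 0 = 1 := by
    intro I
    simp [hCI, h0]
  choose ν hνP hνC using fun I => hB I (hpdI I) (hcontI I) (h0I I)
  -- transport to the product spaces `↥I → ℝ`
  set e : ∀ I : Finset V, (↥I → ℝ) ≃ᵐ EuclideanSpace ℝ ↥I := fun I =>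
    MeasurableEquiv.toLp 2 (↥I → ℝ) with he
  set P : ∀ I : Finset V, Measure (↥I → ℝ) := fun I => (ν I).map (e I).symm with hP
  haveI hPprob : ∀ I, IsProbabilityMeasure (P I) := fun I =>
    Measure.isProbabilityMeasure_map (e I).symm.measurable.aemeasurable
  -- the marginal of `ν I` along `J ⊆ I` is `ν J`
  have hmarg : ∀ (I J : Finset V) (hJI : J ⊆ I),
      (ν I).map ((e J) ∘ Finset.restrict₂ (π := fun _ : V => ℝ) hJI ∘ (e I).symm) = ν J := by
    intro I J hJI
    set incl : ↥J → ↥I := fun j => ⟨j, hJI j.2⟩ with hincl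
    have hg : Measurable ((e J) ∘ Finset.restrict₂ (π := fun _ : V => ℝ) hJI ∘ (e I).symm) :=
      (e J).measurable.comp ((Finset.measurable_restrict₂ (X := fun _ : V => ℝ) hJI).comp (e I).symm.measurable)
    haveI : IsProbabilityMeasure ((ν I).map ((e J) ∘ Finset.restrict₂ (π := fun _ : V => ℝ) hJI ∘
        (e I).symm)) := Measure.isProbabilityMeasure_map hg.aemeasurable
    refine Measure.ext_of_charFun (funext fun s => ?_)
    -- extend `s` by zero to a vector indexed by `I`
    set u : EuclideanSpace ℝ ↥I := toLp 2 fun i => ∑ j : ↥J, if incl j = i then s j else 0 with hu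
    have hinner : ∀ z : EuclideanSpace ℝ ↥I,
        ⟪((e J) ∘ Finset.restrict₂ (π := fun _ : V => ℝ) hJI ∘ (e I).symm) z, s⟫ = ⟪z, u⟫ := by
      intro z
      have h1 : ⟪z, u⟫ = ∑ i : ↥I, u i * z i := by
        simp [PiLp.inner_apply, mul_comm]
      have h2 : ∑ i : ↥I, u i * z i = ∑ j : ↥J, s j * z (incl j) := by
        simpa [hu, smul_eq_mul] using sum_ite_smul_eq incl (fun j => s j) (fun i => z i)
      rw [h1, h2]
      simp [PiLp.inner_apply, Finset.restrict₂, hincl, he]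
    have hvec : (∑ i : ↥I, u i • (i : V)) = ∑ j : ↥J, s j • (j : V) := by
      simpa [hu] using sum_ite_smul_eq incl (fun j => s j) (fun i : ↥I => (i : V))
    rw [charFun_apply, integral_map hg.aemeasurable (by fun_prop)]
    simp_rw [hinner]
    rw [← charFun_apply, hνC I, hνC J]
    simp only [hCI, hLap]
    rw [hvec]
  have hproj : IsProjectiveMeasureFamily (α := fun _ : V => ℝ) P := by
    intro I J hJI
    simp only [hP]
    rw [Measure.map_map (Finset.measurable_restrict₂ (X := fun _ : V => ℝ) hJI)
      (e I).symm.measurable, ← hmarg I J hJI, Measure.map_map (e J).symm.measurable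
        ((e J).measurable.comp ((Finset.measurable_restrict₂ (X := fun _ : V => ℝ) hJI).comp
          (e I).symm.measurable))]
    congr 1
  obtain ⟨μ₀, hμ₀⟩ : ∃ μ₀ : Measure (V → ℝ), IsProjectiveLimit (α := fun _ : V => ℝ) μ₀ P :=
    hK hproj
  haveI : IsProbabilityMeasure μ₀ := hμ₀.isProbabilityMeasure
  refine ⟨μ₀, inferInstance, fun I t => ?_⟩
  have h1 : (fun ω : V → ℝ => (toLp 2 fun i : ↥I => ω ((Subtype.val : ↥I → V) i) : EuclideanSpace ℝ ↥I)) =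
      (e I) ∘ I.restrict := by
    ext ω i
    simp [he, Finset.restrict]
  rw [h1, ← Measure.map_map (e I).measurable (Finset.measurable_restrict I), hμ₀ I]
  simp only [hP]
  rw [Measure.map_map (e I).measurable (e I).symm.measurable]
  simp [hνC I, hCI, hLap]

omit [TopologicalSpace V] [IsTopologicalAddGroup V] [ContinuousSMul ℝ V] in
/-- Universe-polymorphic reindexing of the conclusion of `exists_measure_charFun_evalVec`: the
law of the evaluation vector along *any* finite family `x : κ → V` has characteristic function
`t ↦ C (∑ₖ tₖ • xₖ)` (push the coefficients forward to `I = image x`). [folklore] -/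
theorem charFun_map_evalVec {C : V → ℂ} {μ₀ : Measure (V → ℝ)} [IsProbabilityMeasure μ₀]
    (hμ₀ : ∀ (I : Finset V) (t : EuclideanSpace ℝ ↥I),
      charFun (μ₀.map (fun ω : V → ℝ => (toLp 2 fun i : ↥I => ω ((Subtype.val : ↥I → V) i) : EuclideanSpace ℝ ↥I))) t =
          C (∑ i : ↥I, t i • (i : V)))
    {κ : Type*} [Fintype κ] (x : κ → V) (t : EuclideanSpace ℝ κ) :
    charFun (μ₀.map (fun ω : V → ℝ => (toLp 2 fun k => ω (x k) : EuclideanSpace ℝ κ))) t =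
      C (∑ k, t k • x k) := by
  classical
  set I : Finset V := Finset.univ.image x with hI
  set x' : κ → ↥I := fun k => ⟨x k, Finset.mem_image_of_mem x (Finset.mem_univ k)⟩ with hx'
  set R : EuclideanSpace ℝ ↥I → EuclideanSpace ℝ κ := fun z => toLp 2 fun k => z (x' k) with hR
  have hRm : Measurable R :=
    (WithLp.measurable_toLp 2 _).comp (measurable_pi_lambda _ fun k =>
      (measurable_pi_apply (x' k)).comp (WithLp.measurable_ofLp 2 _))
  have hcomp : (fun ω : V → ℝ => (toLp 2 fun k => ω (x k) : EuclideanSpace ℝ κ)) =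
      R ∘ (fun ω : V → ℝ => (toLp 2 fun i : ↥I => ω ((Subtype.val : ↥I → V) i) : EuclideanSpace ℝ ↥I)) := by
    ext ω k
    simp [hR, hx']
  set u : EuclideanSpace ℝ ↥I := toLp 2 fun i => ∑ k, if x' k = i then t k else 0 with hu
  have hinner : ∀ z : EuclideanSpace ℝ ↥I, ⟪R z, t⟫ = ⟪z, u⟫ := by
    intro z
    have h1 : ⟪z, u⟫ = ∑ i : ↥I, u i * z i := by
      simp [PiLp.inner_apply, mul_comm]
    have h2 : ∑ i : ↥I, u i * z i = ∑ k, t k * z (x' k) := by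
      simpa [hu, smul_eq_mul] using sum_ite_smul_eq x' (fun k => t k) (fun i => z i)
    rw [h1, h2]
    simp [PiLp.inner_apply, hR]
  have hvec : (∑ i : ↥I, u i • (i : V)) = ∑ k, t k • x k := by
    simpa [hu, hx'] using sum_ite_smul_eq x' (fun k => t k) (fun i : ↥I => (i : V))
  rw [hcomp, ← Measure.map_map hRm (measurable_evalVec _), charFun_apply,
    integral_map hRm.aemeasurable (by fun_prop)]
  simp_rw [hinner]
  rw [← charFun_apply, hμ₀ I u, hvec]

omit [TopologicalSpace V] [IsTopologicalAddGroup V] [ContinuousSMul ℝ V] in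
/-- In particular `∫ exp (i ω(f)) dμ₀(ω) = C f` for every `f : V` (the case of a single
coordinate). [folklore] -/
theorem integral_exp_eval {C : V → ℂ} {μ₀ : Measure (V → ℝ)} [IsProbabilityMeasure μ₀]
    (hμ₀ : ∀ (I : Finset V) (t : EuclideanSpace ℝ ↥I),
      charFun (μ₀.map (fun ω : V → ℝ => (toLp 2 fun i : ↥I => ω ((Subtype.val : ↥I → V) i) : EuclideanSpace ℝ ↥I))) t =
          C (∑ i : ↥I, t i • (i : V)))
    (f : V) : ∫ ω : V → ℝ, cexp (I * ((ω f : ℝ) : ℂ)) ∂μ₀ = C f := by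
  have h := hμ₀ {f} (toLp 2 fun _ => 1)
  rw [charFun_apply, integral_map (measurable_evalVec _).aemeasurable (by fun_prop)] at h
  simp only [inner_evalVec (Subtype.val : ↥({f} : Finset V) → V)] at h
  have h1 : ∀ ω : V → ℝ, (∑ k : ↥({f} : Finset V), (toLp 2 fun _ : ↥({f} : Finset V) => (1 : ℝ)) k
      * ω (k : V)) = ω f := by
    intro ω
    rw [Finset.sum_coe_sort {f} (fun v => (1 : ℝ) * ω v)]
    simp
  have h2 : (∑ k : ↥({f} : Finset V), (toLp 2 fun _ : ↥({f} : Finset V) => (1 : ℝ)) k • (k : V))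
      = f := by
    rw [Finset.sum_coe_sort {f} (fun v => (1 : ℝ) • v)]
    simp
  simp_rw [h1] at h
  rw [h2] at h
  rw [← h]
  refine integral_congr_ae (Eventually.of_forall fun ω => ?_)
  simp [mul_comm]

end MinlosProof

end Kolmogorov

section Assembly

open scoped ComplexConjugate NNReal ENNReal RealInnerProductSpace
open MeasureTheory Filter Topology Complex TopologicalSpace WithLp Matrix

namespace MinlosProof

variable {V : Type*} [AddCommGroup V] [Module ℝ V] [TopologicalSpace V]
  [IsTopologicalAddGroup V] [ContinuousSMul ℝ V]

/-! ### Extension of functionals bounded by a continuous seminorm -/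

omit [ContinuousSMul ℝ V] in
/-- **Extension of dominated functionals.** A real function `ω` on `V` whose finite real linear
combinations over a set `S` are bounded by `R q` (`q` a continuous seminorm) agrees on `S` with
a continuous linear functional on `V`: `ω` induces a well-defined linear functional on `span S`
dominated by `R q`, which extends by Hahn–Banach (Mathlib `exists_extension_of_le_sublinear`)
and is continuous being dominated by a continuous seminorm. This replaces the step "`|ξ(x)| ≤ R‖x‖`
on a dense set ⇒ `ξ ∈ E'`" of Yamasaki 1985, Part A §17, proof of Thm 17.1 ((17.8) ⇒ ξ ∈ H₋₁),
§18 Thm 18.2. [cite: Yamasaki1985, Part A §17, Thm 17.1 (proof, (17.8))] -/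
theorem exists_clm_eq_of_bound (q : Seminorm ℝ V) (hq : Continuous q) (S : Set V) {R : ℝ}
    (hR : 0 ≤ R) (ω : V → ℝ)
    (hω : ∀ l : S →₀ ℝ, |l.sum fun s a => a * ω s| ≤ R * q (l.sum fun s a => a • (s : V))) :
    ∃ ω' : V →L[ℝ] ℝ, ∀ s ∈ S, ω' s = ω s := by
  classical
  set Φ : (S →₀ ℝ) →ₗ[ℝ] V := Finsupp.linearCombination ℝ (fun s : S => (s : V)) with hΦ_def
  set Ψ : (S →₀ ℝ) →ₗ[ℝ] ℝ := Finsupp.linearCombination ℝ (fun s : S => ω s) with hΨ_def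
  have hΦ : ∀ l, Φ l = l.sum fun s a => a • (s : V) := fun l => Finsupp.linearCombination_apply _ _
  have hΨ : ∀ l, Ψ l = l.sum fun s a => a * ω s := fun l => by
    simp [hΨ_def, Finsupp.linearCombination_apply]
  have hbound : ∀ l, |Ψ l| ≤ R * q (Φ l) := fun l => by
    rw [hΦ, hΨ]
    exact hω l
  have hker : LinearMap.ker Φ ≤ LinearMap.ker Ψ := by
    intro l hl
    rw [LinearMap.mem_ker] at hl ⊢
    have := hbound l
    rw [hl, map_zero, mul_zero] at this
    exact abs_nonpos_iff.1 this
  set g : LinearMap.range Φ →ₗ[ℝ] ℝ :=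
    (LinearMap.ker Φ).liftQ Ψ hker ∘ₗ Φ.quotKerEquivRange.symm.toLinearMap with hg_def
  have hg : ∀ l, g ⟨Φ l, LinearMap.mem_range_self Φ l⟩ = Ψ l := by
    intro l
    simp [hg_def, Submodule.liftQ_apply]
  set f : V →ₗ.[ℝ] ℝ := ⟨LinearMap.range Φ, g⟩ with hf_def
  have hf : ∀ x : f.domain, f x ≤ R * q x := by
    rintro ⟨x, hx⟩
    obtain ⟨l, rfl⟩ := LinearMap.mem_range.1 hx
    have h1 : f ⟨Φ l, hx⟩ = Ψ l := hg l
    rw [h1]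
    exact (le_abs_self _).trans (hbound l)
  obtain ⟨G, hG1, hG2⟩ := exists_extension_of_le_sublinear f (fun x => R * q x)
    (fun c hc x => by
      simp only [map_smul_eq_mul, Real.norm_eq_abs, abs_of_pos hc]
      ring)
    (fun x y => by
      have := map_add_le_add q x y
      nlinarith)
    hf
  have hGb : ∀ x, |G x| ≤ R * q x := fun x => by
    rw [abs_le]
    refine ⟨?_, hG2 x⟩
    have := hG2 (-x)
    rw [map_neg, map_neg_eq_map] at this
    linarith
  have hGc : Continuous G := by
    refine continuous_of_continuousAt_zero G ?_
    change Tendsto G (𝓝 0) (𝓝 (G 0))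
    rw [map_zero]
    refine squeeze_zero_norm (a := fun x => R * q x) (fun x => ?_) ?_
    · exact (Real.norm_eq_abs _).le.trans (hGb x)
    · have : Tendsto (fun x => R * q x) (𝓝 0) (𝓝 (R * q 0)) :=
        ((continuous_const.mul hq).tendsto 0)
      rwa [map_zero, mul_zero] at this
  refine ⟨⟨G, hGc⟩, fun s hs => ?_⟩
  have hmem : (s : V) ∈ LinearMap.range Φ :=
    ⟨Finsupp.single ⟨s, hs⟩ 1, by simp [hΦ_def]⟩
  have h1 := hG1 ⟨s, hmem⟩
  have h2 : (⟨s, hmem⟩ : LinearMap.range Φ) =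
      ⟨Φ (Finsupp.single ⟨s, hs⟩ 1), LinearMap.mem_range_self Φ _⟩ :=
    Subtype.ext (by simp [hΦ_def])
  change G s = ω s
  change G s = f ⟨s, hmem⟩ at h1
  rw [h1, h2]
  change g ⟨Φ (Finsupp.single ⟨s, hs⟩ 1), LinearMap.mem_range_self Φ _⟩ = ω s
  rw [hg, hΨ]
  simp

/-- Density upgrade: an inequality `|∑ cᵢ wᵢ| ≤ R q(∑ cᵢ sᵢ)` between continuous functions of
the coefficient vector `c` that holds for rational coefficients holds for real ones
(`DenseRange.piMap`, `isClosed_le`). [folklore] -/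
theorem forall_real_of_forall_rat {ι : Type*} [Fintype ι] (q : Seminorm ℝ V) (hq : Continuous q)
    (s : ι → V) (w : ι → ℝ) (R : ℝ)
    (h : ∀ c : ι → ℚ, |∑ i, (c i : ℝ) * w i| ≤ R * q (∑ i, (c i : ℝ) • s i)) (c : ι → ℝ) :
    |∑ i, c i * w i| ≤ R * q (∑ i, c i • s i) := by
  have hd : DenseRange (fun (c : ι → ℚ) (i : ι) => (c i : ℝ)) :=
    DenseRange.piMap fun _ => Rat.denseRange_cast
  refine hd.induction_on (p := fun c : ι → ℝ => |∑ i, c i * w i| ≤ R * q (∑ i, c i • s i)) c ?_ h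
  refine isClosed_le (by fun_prop) (continuous_const.mul (hq.comp ?_))
  exact continuous_finsetSum _ fun i _ => (continuous_apply i).smul continuous_const

section Gram

variable {ι : Type*} [Fintype ι]

omit [IsTopologicalAddGroup V] [ContinuousSMul ℝ V] in
/-- The Gram matrix `M j k = ∑ₘ ψₘ(xⱼ) ψₘ(x_k)` of a pointwise square-summable family of
functionals along a finite family of vectors has quadratic form
`tᵀ M t = ∑ₘ ψₘ(∑ⱼ tⱼ xⱼ)²` (the Hilbertian seminorm of `ψ` restricted to the span,
in coordinates). [folklore] -/
theorem gram_quadratic_form (ψ : ℕ → V →L[ℝ] ℝ) (hψ : ∀ f, Summable fun m => ψ m f ^ 2)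
    (x : ι → V) (t : ι → ℝ) :
    t ⬝ᵥ (Matrix.of fun j k => ∑' m, ψ m (x j) * ψ m (x k)) *ᵥ t =
      ∑' m, ψ m (∑ j, t j • x j) ^ 2 := by
  have hs : ∀ j k, Summable fun m => ψ m (x j) * ψ m (x k) := fun j k =>
    (tsum_mul_le_of_sq (hψ (x j)) (hψ (x k))).1
  have h1 : ∀ m, ψ m (∑ j, t j • x j) ^ 2 = ∑ j, ∑ k, t j * t k * (ψ m (x j) * ψ m (x k)) := by
    intro m
    rw [map_sum, sq, Finset.sum_mul_sum]
    refine Finset.sum_congr rfl fun j _ => Finset.sum_congr rfl fun k _ => ?_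
    simp only [map_smul, smul_eq_mul]
    ring
  simp_rw [h1]
  rw [Summable.tsum_finsetSum (fun j _ => summable_sum fun k _ => (hs j k).mul_left _)]
  simp only [dotProduct, mulVec, Matrix.of_apply]
  refine Finset.sum_congr rfl fun j _ => ?_
  rw [Summable.tsum_finsetSum (fun k _ => (hs j k).mul_left _), Finset.mul_sum]
  refine Finset.sum_congr rfl fun k _ => ?_
  rw [tsum_mul_left]
  ring

omit [IsTopologicalAddGroup V] [ContinuousSMul ℝ V] in
/-- The Gram matrix `M j k = ∑ₘ ψₘ(xⱼ) ψₘ(x_k)` is positive semidefinite. [folklore] -/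
theorem gram_posSemidef (ψ : ℕ → V →L[ℝ] ℝ) (hψ : ∀ f, Summable fun m => ψ m f ^ 2)
    (x : ι → V) : (Matrix.of fun j k => ∑' m, ψ m (x j) * ψ m (x k)).PosSemidef := by
  refine Matrix.PosSemidef.of_dotProduct_mulVec_nonneg ?_ fun t => ?_
  · refine Matrix.IsHermitian.ext fun j k => ?_
    simp only [Matrix.of_apply, star_trivial]
    exact tsum_congr fun m => mul_comm _ _
  · rw [star_trivial, gram_quadratic_form ψ hψ x t]
    exact tsum_nonneg fun m => sq_nonneg _

end Gram

/-! ### Thickness of the topological dual -/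

variable [LocallyConvexSpace ℝ V]

/-- **The topological dual is thick** for the Kolmogorov measure of a characteristic functional
on a nuclear space. Let `V` be nuclear and locally convex, `C` a characteristic functional and
`μ₀` a probability measure on `V → ℝ` whose finite-dimensional distributions have characteristic
functions `t ↦ C (∑ tᵢ • xᵢ)`. Then every product-measurable set `E` containing (the graphs of)
all continuous linear functionals has `μ₀ E = 1`. Proof: `E` depends on a countable set `S` of
coordinates (`MeasurableSet.eq_preimage_restrict_countable`); with the Minlos data
`φ, ψ, b, q` for `ε` (`exists_minlosData`) and `R² = 2∑bₙ²/ε + 1`, the set `A` of `ω` with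
`|∑ cᵢ ω(sᵢ)| ≤ R q(∑ cᵢ sᵢ)` for all rational finite combinations over `S` is contained in `E`
(`exists_clm_eq_of_bound`), and each finite union of the countably many violation events is
bounded through a finite-dimensional marginal by the Minlos–Sazonov estimate
`MinlosSazonov.measure_setOf_sq_inner_gt_le` with the Gram matrix of `ψ`, giving
`μ₀ Aᶜ ≤ (ε + 2∑bₙ²/R²)/(1 - e^{-1/2}) ≤ δ`. Yamasaki 1985, Part A §18 Thm 18.2 (measure of a
continuous p.d. `χ` w.r.t. `‖·‖₁ ≻_{HS} ‖·‖` lies on `E'_{‖·‖}`) and §20 Thm 20.1 (a) (nuclear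
`E`: the measure lies on `E'`), via the proof of §17 Thm 17.1. [cite: Yamasaki1985, Part A §18 Thm 18.2 and §20 Thm 20.1 (a)] -/
theorem measure_eq_one_of_forall_clm_mem [NuclearSpace ℝ V] {C : V → ℂ}
    (hC : IsCharacteristicFunctionalOn C) {μ₀ : Measure (V → ℝ)} [IsProbabilityMeasure μ₀]
    (hμ₀ : ∀ (I : Finset V) (t : EuclideanSpace ℝ ↥I),
      charFun (μ₀.map (fun ω : V → ℝ => (toLp 2 fun i : ↥I => ω ((Subtype.val : ↥I → V) i) : EuclideanSpace ℝ ↥I))) t =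
          C (∑ i : ↥I, t i • (i : V)))
    {E : Set (V → ℝ)} (hE : MeasurableSet E) (hLE : ∀ ω' : V →L[ℝ] ℝ, (⇑ω' : V → ℝ) ∈ E) :
    μ₀ E = 1 := by
  classical
  obtain ⟨S, B, hS, rfl⟩ := hE.eq_preimage_restrict_countable
  suffices h : ∀ δ : ℝ, 0 < δ → μ₀ (S.restrict ⁻¹' B)ᶜ ≤ ENNReal.ofReal δ by
    have h0 : μ₀ (S.restrict ⁻¹' B)ᶜ = 0 := by
      refine le_antisymm (ENNReal.le_of_forall_pos_le_add fun η hη _ => ?_) bot_le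
      rw [zero_add, ← ENNReal.ofReal_coe_nnreal]
      exact h η (by exact_mod_cast hη)
    exact (prob_compl_eq_zero_iff hE).1 h0
  intro δ hδ
  -- constants
  set κ₀ : ℝ := 1 - Real.exp (-1 / 2) with hκ₀_def
  have hκ₀ : 0 < κ₀ := sub_pos.2 (Real.exp_lt_one_iff.2 (by norm_num))
  set ε : ℝ := δ * κ₀ / 2 with hε_def
  have hε : 0 < ε := by positivity
  obtain ⟨φ, ψ, b, q, hψ, hb, hφs, hqc, hq2, hφq, hCφ⟩ := exists_minlosData hC hε
  set h2 : ℝ := ∑' n, b n ^ 2 with hh2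
  have h2nn : 0 ≤ h2 := tsum_nonneg fun n => sq_nonneg _
  set R : ℝ := Real.sqrt (2 * h2 / ε + 1) with hR_def
  have hR2 : R ^ 2 = 2 * h2 / ε + 1 := Real.sq_sqrt (by positivity)
  have hR : 0 < R := Real.sqrt_pos.2 (by positivity)
  have hbound : (ε + 2 * h2 / R ^ 2) / κ₀ ≤ δ := by
    rw [div_le_iff₀ hκ₀]
    have h1 : 2 * h2 / R ^ 2 ≤ ε := by
      rw [div_le_iff₀ (by positivity), hR2]
      have : ε * (2 * h2 / ε + 1) = 2 * h2 + ε := by field_simp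
      rw [this]
      linarith
    have h3 : ε + ε = δ * κ₀ := by rw [hε_def]; ring
    linarith
  -- the countable family of constraints: rational combinations of points of `S`
  haveI : Countable ↥S := hS.to_subtype
  set K := Σ I : Finset ↥S, (↥I → ℚ) with hK_def
  set vec : K → V := fun k => ∑ i : ↥k.1, (k.2 i : ℝ) • ((i : ↥S) : V) with hvec_def
  set ev : K → (V → ℝ) → ℝ := fun k ω => ∑ i : ↥k.1, (k.2 i : ℝ) * ω ((i : ↥S) : V) with hev_def
  set A : Set (V → ℝ) := {ω | ∀ k : K, |ev k ω| ≤ R * q (vec k)} with hA_def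
  -- Claim 1: `A ⊆ E`
  have hAE : A ⊆ S.restrict ⁻¹' B := by
    intro ω hω
    have hreal : ∀ (I : Finset ↥S) (c : ↥I → ℝ),
        |∑ i, c i * ω ((i : ↥S) : V)| ≤ R * q (∑ i, c i • ((i : ↥S) : V)) := fun I =>
      forall_real_of_forall_rat q hqc (fun i : ↥I => ((i : ↥S) : V)) (fun i => ω ((i : ↥S) : V)) R
        fun c => hω ⟨I, c⟩
    have hfs : ∀ l : ↥S →₀ ℝ, |l.sum fun s a => a * ω s| ≤ R * q (l.sum fun s a => a • (s : V)) := by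
      intro l
      simp only [Finsupp.sum]
      rw [← Finset.sum_coe_sort l.support, ← Finset.sum_coe_sort l.support]
      exact hreal l.support fun i => l i
    obtain ⟨ω', hω'⟩ := exists_clm_eq_of_bound q hqc S hR.le ω hfs
    have heq : S.restrict ω = S.restrict (⇑ω' : V → ℝ) := funext fun s => (hω' s s.2).symm
    change S.restrict ω ∈ B
    rw [heq]
    exact hLE ω'
  -- Claim 2: finite unions of violation events are small
  set Viol : K → Set (V → ℝ) := fun k => {ω | R * q (vec k) < |ev k ω|} with hViol_def
  have hAc : Aᶜ = ⋃ k, Viol k := by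
    ext ω
    simp [hA_def, hViol_def, not_le]
  have hfin : ∀ F : Finset K, μ₀ (⋃ k ∈ F, Viol k) ≤ ENNReal.ofReal δ := by
    intro F
    set I₀ : Finset ↥S := F.sup fun k => k.1 with hI₀_def
    set pts : ↥I₀ → V := fun i => ((i : ↥S) : V) with hpts_def
    set ν : Measure (EuclideanSpace ℝ ↥I₀) := μ₀.map (fun ω : V → ℝ => (toLp 2 fun i : ↥I₀ => ω (pts i) : EuclideanSpace ℝ ↥I₀)) with hν_def
    haveI : IsProbabilityMeasure ν :=
      Measure.isProbabilityMeasure_map (measurable_evalVec pts).aemeasurable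
    have hνchar : ∀ t : EuclideanSpace ℝ ↥I₀, charFun ν t = C (∑ i, t i • pts i) := fun t =>
      charFun_map_evalVec hμ₀ pts t
    -- Gram matrix of `ψ` and the vectors `aₙ = (φₙ (pts i))ᵢ`
    set M : Matrix ↥I₀ ↥I₀ ℝ := Matrix.of fun j k => ∑' m, ψ m (pts j) * ψ m (pts k) with hM_def
    have hMq : ∀ t : ↥I₀ → ℝ, t ⬝ᵥ M *ᵥ t = ∑' m, ψ m (∑ j, t j • pts j) ^ 2 :=
      gram_quadratic_form ψ hψ pts
    have hM : M.PosSemidef := gram_posSemidef ψ hψ pts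
    set a : ℕ → EuclideanSpace ℝ ↥I₀ := fun n => toLp 2 fun i => φ n (pts i) with ha_def
    have hinner_a : ∀ n (t : EuclideanSpace ℝ ↥I₀), ⟪a n, t⟫ = φ n (∑ j, t j • pts j) := by
      intro n t
      simp [ha_def, PiLp.inner_apply, map_sum, map_smul]
    have hab : ∀ n (t : EuclideanSpace ℝ ↥I₀), ⟪a n, t⟫ ^ 2 ≤ b n ^ 2 * (ofLp t ⬝ᵥ M *ᵥ ofLp t) := by
      intro n t
      rw [hinner_a, hMq]
      exact hφq n _
    have hν : ∀ t : EuclideanSpace ℝ ↥I₀, 1 - (charFun ν t).re ≤ ε + 2 * ∑' n, ⟪a n, t⟫ ^ 2 := by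
      intro t
      simp_rw [hνchar, hinner_a]
      exact hCφ _
    have hFD := MinlosSazonov.measure_setOf_sq_inner_gt_le ν hM a b hR hab hb le_rfl hν
    -- inclusion of the violation events in the bad event of the marginal
    have hincl : (⋃ k ∈ F, Viol k) ⊆
        (fun ω : V → ℝ => (toLp 2 fun i : ↥I₀ => ω (pts i) : EuclideanSpace ℝ ↥I₀)) ⁻¹'
          {y | ∃ t : EuclideanSpace ℝ ↥I₀,
          R ^ 2 * (ofLp t ⬝ᵥ M *ᵥ ofLp t) < ⟪y, t⟫ ^ 2} := by
      intro ω hω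
      simp only [Set.mem_iUnion, exists_prop] at hω
      obtain ⟨k, hkF, hk⟩ := hω
      have hkI : k.1 ⊆ I₀ := Finset.le_sup (f := fun k : K => k.1) hkF
      set incl : ↥k.1 → ↥I₀ := fun i => ⟨i, hkI i.2⟩ with hincl_def
      set t : EuclideanSpace ℝ ↥I₀ :=
        toLp 2 fun j => ∑ i : ↥k.1, if incl i = j then (k.2 i : ℝ) else 0 with ht_def
      have ht_inner : ⟪(toLp 2 fun i : ↥I₀ => ω (pts i) : EuclideanSpace ℝ ↥I₀), t⟫ = ev k ω := by
        rw [inner_evalVec pts ω t]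
        simpa [ht_def, hev_def, hpts_def, hincl_def, smul_eq_mul] using
          sum_ite_smul_eq incl (fun i => (k.2 i : ℝ)) (fun j => ω (pts j))
      have ht_vec : (∑ j, t j • pts j) = vec k := by
        simpa [ht_def, hvec_def, hpts_def, hincl_def] using
          sum_ite_smul_eq incl (fun i => (k.2 i : ℝ)) pts
      refine ⟨t, ?_⟩
      rw [ht_inner, hMq, ht_vec, ← hq2]
      have hk' : R * q (vec k) < |ev k ω| := hk
      have h0 : 0 ≤ R * q (vec k) := mul_nonneg hR.le (apply_nonneg q _)
      calc R ^ 2 * q (vec k) ^ 2 = (R * q (vec k)) ^ 2 := by ring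
        _ < |ev k ω| ^ 2 := pow_lt_pow_left₀ hk' h0 two_ne_zero
        _ = ev k ω ^ 2 := sq_abs _
    calc μ₀ (⋃ k ∈ F, Viol k)
        ≤ μ₀ ((fun ω : V → ℝ => (toLp 2 fun i : ↥I₀ => ω (pts i) : EuclideanSpace ℝ ↥I₀)) ⁻¹'
            {y | ∃ t : EuclideanSpace ℝ ↥I₀,
            R ^ 2 * (ofLp t ⬝ᵥ M *ᵥ ofLp t) < ⟪y, t⟫ ^ 2}) := measure_mono hincl
      _ ≤ ν {y | ∃ t : EuclideanSpace ℝ ↥I₀, R ^ 2 * (ofLp t ⬝ᵥ M *ᵥ ofLp t) < ⟪y, t⟫ ^ 2} :=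
          Measure.le_map_apply (measurable_evalVec pts).aemeasurable _
      _ ≤ ENNReal.ofReal ((ε + 2 * h2 / R ^ 2) / (1 - Real.exp (-1 / 2))) := hFD
      _ ≤ ENNReal.ofReal δ := ENNReal.ofReal_le_ofReal hbound
  -- Claim 2 ⇒ `μ₀ Aᶜ ≤ δ` by exhaustion
  have hAc_le : μ₀ Aᶜ ≤ ENNReal.ofReal δ := by
    haveI : Nonempty K := ⟨⟨∅, fun i => 0⟩⟩
    obtain ⟨e, he⟩ := exists_surjective_nat K
    rw [hAc, ← he.iUnion_comp, ← Set.iUnion_accumulate]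
    rw [Set.monotone_accumulate.measure_iUnion]
    refine iSup_le fun n => ?_
    refine (measure_mono ?_).trans (hfin ((Finset.range (n + 1)).image e))
    intro ω hω
    obtain ⟨y, hy, hω⟩ := Set.mem_accumulate.1 hω
    simp only [Set.mem_iUnion, exists_prop, Finset.mem_image, Finset.mem_range]
    exact ⟨e y, ⟨y, Nat.lt_succ_of_le hy, rfl⟩, hω⟩
  calc μ₀ (S.restrict ⁻¹' B)ᶜ ≤ μ₀ Aᶜ := measure_mono (Set.compl_subset_compl.2 hAE)
    _ ≤ ENNReal.ofReal δ := hAc_le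

end MinlosProof

/-! ### Minlos' theorem from Bochner and Kolmogorov -/

section Reduction

variable {V : Type*} [AddCommGroup V] [Module ℝ V] [TopologicalSpace V]
  [IsTopologicalAddGroup V] [ContinuousSMul ℝ V]

open MinlosProof in
variable (V) in
/-- **Minlos' theorem, reduced to Bochner and Kolmogorov.** If Bochner's theorem holds on the
Euclidean spaces `ℝ^I` (`I : Finset V`; named fact `IsPositiveDefinite.exists_charFun_eq`) and
the Kolmogorov extension theorem holds for real-valued families indexed by `V` (named fact
`exists_isProjectiveLimit`), then Minlos' theorem `Literature.minlos V` holds for the nuclear locally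
convex space `V`: uniqueness by `ext_of_genFunctionalOf_eq`; existence by the Kolmogorov measure
of `C` on `V → ℝ` (`MinlosProof.exists_measure_charFun_evalVec`), thickness of the topological
dual (`MinlosProof.measure_eq_one_of_forall_clm_mem`) and the trace construction
(`MinlosProof.exists_measure_map_eq_of_thick`) along `ω ↦ ⇑ω`, whose induced σ-algebra is the
cylinder σ-algebra (`dualCylinderSigma_eq_comap_pi`). Yamasaki 1985, Part A, §20 Thm 20.1 (a)
with §15 Thm 15.2 and §16 Thm 16.2; Minlos 1959; Gel'fand–Vilenkin IV, Ch. IV §4.2 Thm 2.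
[cite: Yamasaki1985, Part A §20, Thm 20.1 (a)] [cite: Minlos1959] [cite: GelfandVilenkinIV1964, Ch. IV §4.2 Thm. 2] -/
theorem minlos_of_bochner_of_kolmogorov
    (hB : ∀ I : Finset V, IsPositiveDefinite.exists_charFun_eq (E := EuclideanSpace ℝ ↥I))
    (hK : Literature.Probability.Process.exists_isProjectiveLimit (ι := V) (α := fun _ => ℝ)) : minlos V := by
  intro _ _ C hC
  letI : MeasurableSpace (V →Lₚₜ[ℝ] ℝ) := dualCylinderSigma V
  obtain ⟨μ₀, hμ₀P, hμ₀⟩ := exists_measure_charFun_evalVec hB hK hC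
  set ι : (V →Lₚₜ[ℝ] ℝ) → (V → ℝ) := fun ω => (⇑ω : V → ℝ) with hι_def
  have hι : Measurable ι := measurable_pi_lambda _ fun f => measurable_eval_dualCylinderSigma f
  have hsurj : ∀ s : Set (V →Lₚₜ[ℝ] ℝ), MeasurableSet s → ∃ E, MeasurableSet E ∧ ι ⁻¹' E = s := by
    intro s hs
    have hs' : MeasurableSet[(MeasurableSpace.pi : MeasurableSpace (V → ℝ)).comap ι] s := by
      rw [← dualCylinderSigma_eq_comap_pi]
      exact hs
    exact hs'
  have hthick : ∀ E, MeasurableSet E → Set.range ι ⊆ E → μ₀ E = μ₀ Set.univ := by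
    intro E hE hrange
    rw [measure_univ]
    refine measure_eq_one_of_forall_clm_mem hC hμ₀ hE fun ω' => ?_
    exact hrange ⟨(show V →Lₚₜ[ℝ] ℝ from ω'), rfl⟩
  obtain ⟨μ, hμ⟩ := exists_measure_map_eq_of_thick μ₀ hι hsurj hthick
  have hprob : IsProbabilityMeasure μ := ⟨by
    rw [← Set.preimage_univ (f := ι), ← Measure.map_apply hι MeasurableSet.univ, hμ, measure_univ]⟩
  have hgen : ∀ f, genFunctionalOf μ f = C f := by
    intro f
    rw [← integral_exp_eval hμ₀ f, ← hμ, integral_map hι.aemeasurable]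
    · rfl
    · exact (Complex.measurable_exp.comp (measurable_const.mul
        (Complex.measurable_ofReal.comp (measurable_pi_apply f)))).aestronglyMeasurable
  refine ⟨μ, ⟨hprob, hgen⟩, ?_⟩
  rintro μ' ⟨hprob', hgen'⟩
  exact ext_of_genFunctionalOf_eq rfl fun f => (hgen' f).trans (hgen f).symm

variable (V) in
/-- **Minlos' theorem** (discharge of the named fact `Literature.Analysis.FunctionSpaces.minlos`): on a nuclear locally convex
space `V`, every characteristic functional (continuous, positive definite, `C 0 = 1`) is the
generating functional of a unique probability measure on the cylinder σ-algebra of the weak-*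
dual `V'`. From `minlos_of_bochner_of_kolmogorov`, Bochner's theorem
(`IsPositiveDefinite.exists_charFun_eq_holds`) and the Kolmogorov extension theorem
(`exists_isProjectiveLimit_holds`). Minlos, Trudy MMO 8 (1959); Gel'fand–Vilenkin IV, Ch. IV
§4.2 Thm 2 (existence), §4.1 (uniqueness); in the generality of an arbitrary nuclear space:
Yamasaki 1985, Part A §20, Thm 20.1 (a). [cite: GelfandVilenkinIV1964, Ch. IV §4.2 Thm. 2 (existence) and §4.1 (uniqueness)] [cite: Minlos1959] [cite: Yamasaki1985, Part A §20, Thm 20.1 (a)] -/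
theorem minlos_holds : minlos V :=
  minlos_of_bochner_of_kolmogorov V (fun _ => IsPositiveDefinite.exists_charFun_eq_holds)
    Literature.Probability.Process.exists_isProjectiveLimit_holds

end Reduction

end Assembly

section Converse

open scoped ComplexConjugate NNReal
open MeasureTheory Filter Topology Complex TopologicalSpace

variable {V : Type*} [AddCommGroup V] [Module ℝ V] [TopologicalSpace V]

/-- **The converse of Minlos' theorem** (discharge of the named fact
`Literature.Analysis.FunctionSpaces.isCharacteristicFunctionalOn_genFunctionalOf`): for first countable `V`, the generating
functional of a probability measure on the dual (any σ-algebra making the evaluations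
measurable) is a characteristic functional — normalised, continuous by dominated convergence
(`continuous_of_dominated`, using first countability), and positive definite since
`∑ᵢⱼ conj cᵢ cⱼ S(fⱼ - fᵢ) = ∫ |∑ⱼ cⱼ e^{iω(fⱼ)}|² dμ ≥ 0`. Gel'fand–Vilenkin IV, Ch. IV §4.1;
Yamasaki 1985, Part A §16 (properties of `χ`). [cite: GelfandVilenkinIV1964, Ch. IV §4.1] [cite: Yamasaki1985, Part A §16, Thm 16.2] -/
theorem isCharacteristicFunctionalOn_genFunctionalOf_holds :
    isCharacteristicFunctionalOn_genFunctionalOf (V := V) := by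
  intro _ m hm μ _
  have hmeas : ∀ f : V, Measurable fun ω : V →Lₚₜ[ℝ] ℝ => ω f := fun f =>
    (measurable_eval_dualCylinderSigma f).mono hm le_rfl
  obtain ⟨e, he⟩ : ∃ e : V → (V →Lₚₜ[ℝ] ℝ) → ℂ, ∀ f ω, e f ω = cexp (I * ((ω f : ℝ) : ℂ)) :=
    ⟨_, fun _ _ => rfl⟩
  have hem : ∀ f, Measurable (e f) := fun f => by
    have : e f = fun ω => cexp (I * ((ω f : ℝ) : ℂ)) := funext (he f)
    rw [this]
    exact Complex.measurable_exp.comp (measurable_const.mul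
      (Complex.measurable_ofReal.comp (hmeas f)))
  have hnorm : ∀ f ω, ‖e f ω‖ = 1 := fun f ω => by
    rw [he, mul_comm, Complex.norm_exp_ofReal_mul_I]
  have hgen : ∀ f, genFunctionalOf μ f = ∫ ω, e f ω ∂μ := fun f => by
    simp only [genFunctionalOf, he]
  refine ⟨?_, ?_, ?_⟩
  · rw [hgen]
    simp [he]
  · have : genFunctionalOf μ = fun f => ∫ ω, e f ω ∂μ := funext hgen
    rw [this]
    refine continuous_of_dominated (bound := fun _ => 1) (fun f => (hem f).aestronglyMeasurable)
      (fun f => ae_of_all _ fun ω => (hnorm f ω).le) (integrable_const 1)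
      (ae_of_all _ fun ω => ?_)
    have : (fun f => e f ω) = fun f => cexp (I * ((ω f : ℝ) : ℂ)) := funext fun f => he f ω
    rw [this]
    fun_prop
  · intro n x c
    obtain ⟨F, hF⟩ : ∃ F : Fin n → Fin n → (V →Lₚₜ[ℝ] ℝ) → ℂ, ∀ i j ω,
        F i j ω = conj (c i) * c j * (e (x j) ω * conj (e (x i) ω)) := ⟨_, fun _ _ _ => rfl⟩
    have hFm : ∀ i j, Measurable (F i j) := fun i j => by
      have : F i j = fun ω => conj (c i) * c j * (e (x j) ω * conj (e (x i) ω)) :=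
        funext (hF i j)
      rw [this]
      exact measurable_const.mul ((hem _).mul (Complex.continuous_conj.measurable.comp (hem _)))
    have hint : ∀ i j, Integrable (F i j) μ := fun i j =>
      (integrable_const (‖c i‖ * ‖c j‖)).mono' (hFm i j).aestronglyMeasurable
        (Eventually.of_forall fun ω => by
          rw [hF, norm_mul, norm_mul, norm_mul, Complex.norm_conj, Complex.norm_conj, hnorm,
            hnorm, mul_one, mul_one])
    have hkey : (∑ i, ∑ j, conj (c i) * c j * genFunctionalOf μ (x j - x i)) =
        ∫ ω, ((Complex.normSq (∑ j, c j * e (x j) ω) : ℝ) : ℂ) ∂μ := by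
      have h1 : ∀ i j, conj (c i) * c j * genFunctionalOf μ (x j - x i) = ∫ ω, F i j ω ∂μ := by
        intro i j
        rw [hgen, ← integral_const_mul]
        refine integral_congr_ae (Eventually.of_forall fun ω => ?_)
        dsimp only
        rw [hF, he, he, he, map_sub, Complex.ofReal_sub, ← Complex.exp_conj, map_mul,
          Complex.conj_I, Complex.conj_ofReal, ← Complex.exp_add]
        congr 2
        ring
      have h2 : ∀ i, ∑ j, ∫ ω, F i j ω ∂μ = ∫ ω, ∑ j, F i j ω ∂μ := fun i =>
        (integral_finsetSum _ (fun j _ => hint i j)).symm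
      simp_rw [h1, h2]
      rw [← integral_finsetSum _ (fun i _ => integrable_finsetSum _ fun j _ => hint i j)]
      refine integral_congr_ae (Eventually.of_forall fun ω => ?_)
      simp only [hF]
      rw [← Complex.mul_conj, map_sum, Finset.sum_mul_sum, Finset.sum_comm]
      refine Finset.sum_congr rfl fun i _ => Finset.sum_congr rfl fun j _ => ?_
      simp only [map_mul]
      ring
    rw [hkey, integral_complex_ofReal]
    exact ⟨by simpa using integral_nonneg fun ω => Complex.normSq_nonneg _, by simp⟩

end Converse

end Literature.Analysis.FunctionSpaces
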